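import Literature.NumberTheory.DiophantineGeometry.NoncriticalBelyiPolar
import HarnessLib

/-!
# Noncritical Belyi maps on `ℙ¹`, step V-b: protecting a FINITE set of points by pole-composition

S. Mochizuki, *Noncritical Belyi maps*, Math. J. Okayama Univ. **46** (2004) 105–113
[cite: MochizukiNCBelyi2004], Theorem 2.5 in genus `0` with an arbitrary finite exceptional set `T`
("`φ(T) ∩ {0, 1, ∞} = ∅`"); equivalently Scherr–Zieve, *Separated Belyi maps*, Math. Res. Lett.
**21** (2014) [cite: ScherrZieve2014], Theorem 1 for `C = ℙ¹` ("for disjoint finite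
`S, T ⊂ C(Q̄)` there is a Belyi map `φ` with `φ(S) ⊆ {0,1,∞}` and `φ(T) ∩ {0,1,∞} = ∅`").
Reduction of a finite protected set to the one-point case (`∞`, abc-iut-S7's
`exists_belyi_noncritical_infty`) by the pole-substitution of `NoncriticalBelyiPolar.lean`
(`g = x + M'/M`, `S_n(p) = M^n·p(g)`), in the `(p, q)`-format of
`BelyiPreimageCount.card_cusp_preimages`:

* `wronskian_polar_eq_zero` — the chain rule off the poles: a finite critical point of `β ∘ g` with
  `M ≠ 0` is a critical point of `g` (a zero of `M² + MM'' − M'²`) or lies over a critical point of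
  `β` (complex derivatives, as in `NoncriticalBelyiMoebius.lean`);
* `polar_main` — **the composition theorem**: if `(p, q)` is a Belyi pair of degree `n ≥ 1`
  noncritical at `∞` sending `g(A)` and the critical values of `g` into `{0,1,∞}`, then
  `(S_n p, S_n q)` is a Belyi pair of degree `n(deg M + 1)` noncritical at `∞`, sends `A` into
  `{0,1,∞}` and takes the value `p_n/q_n ∉ {0,1,∞}` at every root of `M` (at the poles the Wronskian
  is `M'(γ)^{2n}(p_{n−1}q_n − p_n q_{n−1}) ≠ 0`);
* `exists_belyi_protecting_roots_of` — the noncritical Belyi map on `ℙ¹` for a finite set `A` of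
  algebraic numbers protecting the roots of a separable `M` (and `∞`), stated OVER the one-point
  theorem as a hypothesis (apply it to `A' = g(A) ∪ g(crit g)`), so that this file does not wait
  for that olean.

No definitions, no named facts; classical and undisputed.  (Use in the abc-iut cell: the `ℙ¹` half
of the "iterated protection" covering for [GenEll] Thm. 2.1 (ii) ⇒ (i), route item GenEllTwo; nothing
here bears on [IUTchIII] Cor. 3.12.)
-/
namespace Literature.NumberTheory.DiophantineGeometry

open Polynomial Finset

namespace NoncriticalBelyi

/-! ### The chain rule off the poles -/

/-- `g(x) = x + M'(x)/M(x)` has derivative `(M² + M·M'' − M'²)/M²` at a non-pole. [folklore] -/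
private theorem hasDerivAt_g (M : ℚ[X]) (z : ℂ) (hz : aeval z M ≠ 0) :
    HasDerivAt (fun x : ℂ => x + aeval x (derivative M) / aeval x M)
      (aeval z (M ^ 2 + M * derivative (derivative M) - derivative M ^ 2) / (aeval z M) ^ 2) z := by
  have h1 : HasDerivAt (fun x : ℂ => aeval x (derivative M)) (aeval z (derivative (derivative M))) z :=
    (derivative M).hasDerivAt_aeval z
  have h2 : HasDerivAt (fun x : ℂ => aeval x M) (aeval z (derivative M)) z := M.hasDerivAt_aeval z
  have h3 := (hasDerivAt_id' z).add (h1.div h2 hz)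
  refine h3.congr_deriv ?_
  have e : aeval z (M ^ 2 + M * derivative (derivative M) - derivative M ^ 2) =
      aeval z M ^ 2 + aeval z M * aeval z (derivative (derivative M)) -
        aeval z (derivative M) ^ 2 := by
    simp only [map_sub, map_add, map_mul, map_pow]
  rw [e]
  field_simp
  ring

/-- **Chain rule at a finite non-polar point.** For `p, q` of degree `≤ n` and a complex `z` with
`M(z) ≠ 0` and `S(q)(z) ≠ 0`: if the Wronskian of `(S(p), S(q))` vanishes at `z`, then either the
Wronskian `p'q − pq'` vanishes at `g(z)` or `z` is a critical point of `g`
(`(M² + MM'' − M'²)(z) = 0`). [cite: ScherrZieve2014, Thm 1 (proof)] -/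
theorem wronskian_polar_eq_zero (p q : ℚ[X]) (n : ℕ) (M : ℚ[X]) (hp : p.natDegree ≤ n)
    (hq : q.natDegree ≤ n) (z : ℂ) (hz : aeval z M ≠ 0)
    (hqz : aeval z (∑ j ∈ range (n + 1), C (q.coeff j) * (X * M + derivative M) ^ j * M ^ (n - j)) ≠ 0)
    (hW : aeval z
      (derivative (∑ j ∈ range (n + 1), C (p.coeff j) * (X * M + derivative M) ^ j * M ^ (n - j)) *
          (∑ j ∈ range (n + 1), C (q.coeff j) * (X * M + derivative M) ^ j * M ^ (n - j)) -
        (∑ j ∈ range (n + 1), C (p.coeff j) * (X * M + derivative M) ^ j * M ^ (n - j)) *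
          derivative (∑ j ∈ range (n + 1), C (q.coeff j) * (X * M + derivative M) ^ j * M ^ (n - j)))
      = 0) :
    aeval (z + aeval z (derivative M) / aeval z M) (derivative p * q - p * derivative q) = 0 ∨
      aeval z (M ^ 2 + M * derivative (derivative M) - derivative M ^ 2) = 0 := by
  set HP : ℚ[X] := ∑ j ∈ range (n + 1), C (p.coeff j) * (X * M + derivative M) ^ j * M ^ (n - j)
    with hHP
  set HQ : ℚ[X] := ∑ j ∈ range (n + 1), C (q.coeff j) * (X * M + derivative M) ^ j * M ^ (n - j)
    with hHQ
  set y : ℂ := z + aeval z (derivative M) / aeval z M with hy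
  -- `q(y) ≠ 0`
  have hQy : aeval y q ≠ 0 := by
    intro h
    apply hqz
    rw [hHQ, aeval_polar q n M hq z hz, ← hy, h, mul_zero]
  -- derivative of `f = S(p)/S(q)` at `z` is `0`
  have hf : HasDerivAt (fun x : ℂ => aeval x HP / aeval x HQ) 0 z := by
    have h := (HP.hasDerivAt_aeval z).div (HQ.hasDerivAt_aeval z) hqz
    have hnum :
        aeval z (derivative HP) * aeval z HQ - aeval z HP * aeval z (derivative HQ) = 0 := by
      rw [← hW, map_sub, map_mul, map_mul]
    rwa [hnum, zero_div] at h
  -- derivative of `(p/q) ∘ g` at `z`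
  set g' : ℂ := aeval z (M ^ 2 + M * derivative (derivative M) - derivative M ^ 2) / (aeval z M) ^ 2
    with hg'
  have hg : HasDerivAt ((fun u : ℂ => aeval u p / aeval u q) ∘
        fun x : ℂ => x + aeval x (derivative M) / aeval x M)
      ((aeval y (derivative p) * aeval y q - aeval y p * aeval y (derivative q)) / (aeval y q) ^ 2 *
        g') z := by
    have hPQ : HasDerivAt (fun u : ℂ => aeval u p / aeval u q)
        ((aeval y (derivative p) * aeval y q - aeval y p * aeval y (derivative q)) /
          (aeval y q) ^ 2) (z + aeval z (derivative M) / aeval z M) := by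
      rw [← hy]; exact (p.hasDerivAt_aeval y).div (q.hasDerivAt_aeval y) hQy
    exact hPQ.comp z (hasDerivAt_g M z hz)
  -- `f = (p/q) ∘ g` near `z`
  have hfg : (fun x : ℂ => aeval x HP / aeval x HQ) =ᶠ[nhds z]
      ((fun u : ℂ => aeval u p / aeval u q) ∘
        fun x : ℂ => x + aeval x (derivative M) / aeval x M) := by
    have hopen : IsOpen {x : ℂ | aeval x M ≠ 0} :=
      isOpen_ne_fun (Polynomial.continuous_aeval M) (by fun_prop)
    filter_upwards [hopen.mem_nhds hz] with x hx
    have hxn : (aeval x M) ^ n ≠ 0 := pow_ne_zero _ hx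
    simp only [Function.comp_apply, hHP, hHQ, aeval_polar p n M hp x hx, aeval_polar q n M hq x hx]
    rw [mul_div_mul_left _ _ hxn]
  have huniq := hf.unique (hg.congr_of_eventuallyEq hfg)
  have hQy2 : (aeval y q) ^ 2 ≠ 0 := pow_ne_zero _ hQy
  have h0 := huniq.symm
  rw [mul_eq_zero, div_eq_zero_iff] at h0
  rcases h0 with (h | h) | h
  · left; rw [map_sub, map_mul, map_mul]; exact h
  · exact absurd h hQy2
  · right
    rw [hg', div_eq_zero_iff] at h
    rcases h with h | h
    · exact h
    · exact absurd h (pow_ne_zero _ hz)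

/-! ### The transformation theorem -/

/-- **Pole-composition of a noncritical Belyi pair.**  Let `(p, q)` be a Belyi pair of degree
`n ≥ 1` noncritical at `∞` in the format of `card_cusp_preimages` (equal degrees `n` of `p, q, p − q`;
`p_{n−1}q_n ≠ p_n q_{n−1}`; coprime; every finite non-polar critical point has value `0` or `1`),
`M ∈ ℚ[x]` separable of positive degree, `g(x) = x + M'(x)/M(x)`, and suppose `β = p/q` sends `g(a)`
for `a ∈ A` (a set of non-roots of `M`) and `g(z)` for every finite critical point `z` of `g` into
`{0, 1, ∞}`.  Then `(P, Q) := (M^n·p(g), M^n·q(g))` (written as polynomials) is a Belyi pair of degree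
`N = n(deg M + 1)` noncritical at `∞`, in the same format, sending `A` into `{0,1,∞}` and with
`β(g(γ)) ∉ {0, 1, ∞}` at every root `γ` of `M` — a noncritical Belyi map protecting the roots of `M`
(and `∞`). [cite: MochizukiNCBelyi2004, Thm 2.5 (genus 0)] -/
theorem polar_main (p q : ℚ[X]) (n : ℕ) (hn : 0 < n) (hp : p.natDegree = n) (hq : q.natDegree = n)
    (hpq : (p - q).natDegree = n)
    (hunr : p.coeff (n - 1) * q.coeff n ≠ p.coeff n * q.coeff (n - 1)) (hcop : IsCoprime p q)
    (hbel : ∀ z : ℂ, aeval z q ≠ 0 → aeval z (derivative p * q - p * derivative q) = 0 →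
      aeval z p = 0 ∨ aeval z p = aeval z q)
    (M : ℚ[X]) (hM : 0 < M.natDegree) (hsep : M.Separable) (A : Set ℂ)
    (hAM : ∀ a ∈ A, aeval a M ≠ 0)
    (hA : ∀ a ∈ A, aeval (a + aeval a (derivative M) / aeval a M) (p * q * (p - q)) = 0)
    (hcrit : ∀ z : ℂ, aeval z M ≠ 0 →
      aeval z (M ^ 2 + M * derivative (derivative M) - derivative M ^ 2) = 0 →
      aeval (z + aeval z (derivative M) / aeval z M) (p * q * (p - q)) = 0) :
    ∃ (P Q : ℚ[X]) (N : ℕ), 0 < N ∧ P.natDegree = N ∧ Q.natDegree = N ∧ (P - Q).natDegree = N ∧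
      P.coeff (N - 1) * Q.coeff N ≠ P.coeff N * Q.coeff (N - 1) ∧ IsCoprime P Q ∧
      (∀ z : ℂ, aeval z Q ≠ 0 → aeval z (derivative P * Q - P * derivative Q) = 0 →
        aeval z P = 0 ∨ aeval z P = aeval z Q) ∧
      (∀ a ∈ A, aeval a (P * Q * (P - Q)) = 0) ∧
      (∀ γ : ℂ, aeval γ M = 0 → aeval γ P ≠ 0 ∧ aeval γ Q ≠ 0 ∧ aeval γ P ≠ aeval γ Q) := by
  classical
  set P : ℚ[X] := ∑ j ∈ range (n + 1), C (p.coeff j) * (X * M + derivative M) ^ j * M ^ (n - j)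
    with hPdef
  set Q : ℚ[X] := ∑ j ∈ range (n + 1), C (q.coeff j) * (X * M + derivative M) ^ j * M ^ (n - j)
    with hQdef
  set N : ℕ := n * (M.natDegree + 1) with hNdef
  set c : ℚ := M.leadingCoeff with hcdef
  have hM0 : M ≠ 0 := by rintro rfl; simp at hM
  have hc : c ≠ 0 := leadingCoeff_ne_zero.mpr hM0
  -- nonvanishing top coefficients of `p`, `q`, `p − q`
  have hp0 : p ≠ 0 := by rintro rfl; rw [natDegree_zero] at hp; omega
  have hq0 : q ≠ 0 := by rintro rfl; rw [natDegree_zero] at hq; omega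
  have hpq0 : p - q ≠ 0 := by intro h; rw [h, natDegree_zero] at hpq; omega
  have hpn : p.coeff n ≠ 0 := by rw [← hp, coeff_natDegree]; exact leadingCoeff_ne_zero.mpr hp0
  have hqn : q.coeff n ≠ 0 := by rw [← hq, coeff_natDegree]; exact leadingCoeff_ne_zero.mpr hq0
  have hpqn : (p - q).coeff n ≠ 0 := by
    rw [← hpq, coeff_natDegree]; exact leadingCoeff_ne_zero.mpr hpq0
  have hPQsub : P - Q =
      ∑ j ∈ range (n + 1), C ((p - q).coeff j) * (X * M + derivative M) ^ j * M ^ (n - j) :=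
    polar_sub p q n M
  -- degrees
  have hPdeg : P.natDegree = N :=
    natDegree_eq_of_le_of_coeff_ne_zero (polar_natDegree_le p n M hM)
      (by rw [polar_coeff_top p n M hM]; exact mul_ne_zero hpn (pow_ne_zero _ hc))
  have hQdeg : Q.natDegree = N :=
    natDegree_eq_of_le_of_coeff_ne_zero (polar_natDegree_le q n M hM)
      (by rw [polar_coeff_top q n M hM]; exact mul_ne_zero hqn (pow_ne_zero _ hc))
  have hPQdeg : (P - Q).natDegree = N := by
    rw [hPQsub]
    exact natDegree_eq_of_le_of_coeff_ne_zero (polar_natDegree_le (p - q) n M hM)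
      (by rw [polar_coeff_top (p - q) n M hM]; exact mul_ne_zero hpqn (pow_ne_zero _ hc))
  -- separability: `M'` does not vanish at the roots of `M`
  have hsep' : ∀ {B : Type} [Field B] [Algebra ℚ B] (z : B), aeval z M = 0 →
      aeval z (derivative M) ≠ 0 := fun z hz => hsep.aeval_derivative_ne_zero hz
  refine ⟨P, Q, N, Nat.mul_pos hn (Nat.succ_pos _), hPdeg, hQdeg, hPQdeg, ?_, ?_, ?_, ?_, ?_⟩
  · -- unramified at `∞`
    have h1 := polar_coeff_pred p n M hM hn
    have h2 := polar_coeff_pred q n M hM hn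
    have h3 := polar_coeff_top p n M hM
    have h4 := polar_coeff_top q n M hM
    rw [hNdef, h1, h2, h3, h4]
    intro h
    apply hunr
    have key : (M.leadingCoeff ^ n * M.leadingCoeff ^ n) *
        (p.coeff (n - 1) * q.coeff n - p.coeff n * q.coeff (n - 1)) = 0 := by
      linear_combination h
    rcases mul_eq_zero.mp key with h' | h'
    · exact absurd h' (mul_ne_zero (pow_ne_zero _ hc) (pow_ne_zero _ hc))
    · exact sub_eq_zero.mp h'
  · -- coprime: no common complex root
    rw [Polynomial.isCoprime_iff_aeval_ne_zero_of_isAlgClosed ℚ ℂ]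
    intro z
    by_cases hz : aeval z M = 0
    · right
      rw [hQdef, aeval_polar_of_root q n M z hz]
      exact mul_ne_zero (by rwa [Ne, map_eq_zero_iff _ (algebraMap ℚ ℂ).injective])
        (pow_ne_zero _ (hsep' z hz))
    · rcases (Polynomial.isCoprime_iff_aeval_ne_zero_of_isAlgClosed ℚ ℂ p q).1 hcop
        (z + aeval z (derivative M) / aeval z M) with h | h
      · left
        rw [hPdef, aeval_polar p n M hp.le z hz]
        exact mul_ne_zero (pow_ne_zero _ hz) h
      · right
        rw [hQdef, aeval_polar q n M hq.le z hz]
        exact mul_ne_zero (pow_ne_zero _ hz) h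
  · -- the Belyi clause
    intro z hQz hWz
    by_cases hz : aeval z M = 0
    · -- at a pole of `g` the composite is unramified: the Wronskian does not vanish
      exfalso
      obtain ⟨k, rfl⟩ : ∃ k, n = k + 1 := ⟨n - 1, by omega⟩
      have ea := hsep' z hz
      set a : ℂ := aeval z (derivative M) with ha
      set b : ℂ := aeval z (derivative (X * M + derivative M)) with hb
      have eP := aeval_polar_of_root p (k + 1) M z hz
      have eQ := aeval_polar_of_root q (k + 1) M z hz
      have eP' := aeval_derivative_polar_of_root p (k + 1) M (by omega) z hz
      have eQ' := aeval_derivative_polar_of_root q (k + 1) M (by omega) z hz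
      simp only [Nat.add_sub_cancel] at eP' eQ' hunr
      rw [← hPdef] at eP eP'
      rw [← hQdef] at eQ eQ'
      simp only [map_sub, map_mul] at hWz
      rw [eP, eQ, eP', eQ'] at hWz
      have key : a ^ (k + 1) * a ^ (k + 1) *
          (algebraMap ℚ ℂ (p.coeff k) * algebraMap ℚ ℂ (q.coeff (k + 1)) -
            algebraMap ℚ ℂ (p.coeff (k + 1)) * algebraMap ℚ ℂ (q.coeff k)) = 0 := by
        rw [← ha, ← hb] at hWz
        linear_combination hWz
      rcases mul_eq_zero.mp key with h | h
      · exact absurd h (mul_ne_zero (pow_ne_zero _ ea) (pow_ne_zero _ ea))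
      · apply hunr
        rw [← map_mul, ← map_mul, ← map_sub, map_eq_zero_iff _ (algebraMap ℚ ℂ).injective] at h
        exact sub_eq_zero.mp h
    · set y : ℂ := z + aeval z (derivative M) / aeval z M with hy
      have hPz : aeval z P = aeval z M ^ n * aeval y p := by rw [hPdef, aeval_polar p n M hp.le z hz]
      have hQz' : aeval z Q = aeval z M ^ n * aeval y q := by rw [hQdef, aeval_polar q n M hq.le z hz]
      have hqy : aeval y q ≠ 0 := by
        intro h; apply hQz; rw [hQz', h, mul_zero]
      have hvals : aeval y p = 0 ∨ aeval y p = aeval y q := by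
        rcases wronskian_polar_eq_zero p q n M hp.le hq.le z hz hQz hWz with h | h
        · exact hbel y hqy h
        · have h2 := hcrit z hz h
          rw [← hy, map_mul, map_mul, map_sub] at h2
          rcases mul_eq_zero.mp h2 with h3 | h3
          · rcases mul_eq_zero.mp h3 with h4 | h4
            · exact Or.inl h4
            · exact absurd h4 hqy
          · exact Or.inr (sub_eq_zero.mp h3)
      rcases hvals with h | h
      · left; rw [hPz, h, mul_zero]
      · right; rw [hPz, hQz', h]
  · -- `A ↦ {0, 1, ∞}`
    intro a ha
    have hz := hAM a ha
    have h := hA a ha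
    rw [map_mul, map_mul, map_sub] at h
    rw [map_mul, map_mul, map_sub, hPdef, hQdef, aeval_polar p n M hp.le a hz,
      aeval_polar q n M hq.le a hz]
    have : aeval a M ^ n * aeval (a + aeval a (derivative M) / aeval a M) p *
          (aeval a M ^ n * aeval (a + aeval a (derivative M) / aeval a M) q) *
          (aeval a M ^ n * aeval (a + aeval a (derivative M) / aeval a M) p -
            aeval a M ^ n * aeval (a + aeval a (derivative M) / aeval a M) q) =
        (aeval a M ^ n) ^ 3 * (aeval (a + aeval a (derivative M) / aeval a M) p *
          aeval (a + aeval a (derivative M) / aeval a M) q *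
          (aeval (a + aeval a (derivative M) / aeval a M) p -
            aeval (a + aeval a (derivative M) / aeval a M) q)) := by ring
    rw [this, h, mul_zero]
  · -- protection of the roots of `M`
    intro γ hγ
    have ea := hsep' γ hγ
    have eP := aeval_polar_of_root p n M γ hγ
    have eQ := aeval_polar_of_root q n M γ hγ
    rw [← hPdef] at eP; rw [← hQdef] at eQ
    have hinj : ∀ x : ℚ, algebraMap ℚ ℂ x = 0 ↔ x = 0 := fun x =>
      map_eq_zero_iff _ (algebraMap ℚ ℂ).injective
    refine ⟨?_, ?_, ?_⟩
    · rw [eP]; exact mul_ne_zero (by rw [Ne, hinj]; exact hpn) (pow_ne_zero _ ea)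
    · rw [eQ]; exact mul_ne_zero (by rw [Ne, hinj]; exact hqn) (pow_ne_zero _ ea)
    · rw [eP, eQ]
      intro h
      have h' : (algebraMap ℚ ℂ (p.coeff n) - algebraMap ℚ ℂ (q.coeff n)) *
          aeval γ (derivative M) ^ n = 0 := by rw [sub_mul, h, sub_self]
      rcases mul_eq_zero.mp h' with h'' | h''
      · rw [← map_sub, hinj, ← coeff_sub] at h''
        exact hpqn h''
      · exact pow_ne_zero _ ea h''

/-! ### The noncritical Belyi map on `ℙ¹` protecting a finite set, over the one-point theorem -/

/-- An element obtained from an integral complex number by field operations with a polynomial is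
integral over `ℚ`: `a + M'(a)/M(a)`. [folklore] -/
private theorem isIntegral_g (M : ℚ[X]) {a : ℂ} (ha : IsIntegral ℚ a) :
    IsIntegral ℚ (a + aeval a (derivative M) / aeval a M) := by
  have hle : Algebra.adjoin ℚ {a} ≤ integralClosure ℚ ℂ :=
    Algebra.adjoin_le (Set.singleton_subset_iff.mpr ((_root_.mem_integralClosure_iff ℚ ℂ).mpr ha))
  have h1 : IsIntegral ℚ (aeval a (derivative M)) :=
    (_root_.mem_integralClosure_iff ℚ ℂ).mp (hle (Polynomial.aeval_mem_adjoin_singleton ℚ a))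
  have h2 : IsIntegral ℚ (aeval a M) :=
    (_root_.mem_integralClosure_iff ℚ ℂ).mp (hle (Polynomial.aeval_mem_adjoin_singleton ℚ a))
  rw [div_eq_mul_inv]
  exact ha.add (h1.mul h2.inv)

/-- The polynomial `M² + MM'' − M'²` (numerator of `g'`) has top coefficient `c²` in degree `2·deg M`,
hence is nonzero, for `M` of positive degree. [folklore] -/
private theorem crit_poly_ne_zero (M : ℚ[X]) (hM : 0 < M.natDegree) :
    M ^ 2 + M * derivative (derivative M) - derivative M ^ 2 ≠ 0 := by
  have hM0 : M ≠ 0 := by rintro rfl; simp at hM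
  intro h
  have hc : (M ^ 2 + M * derivative (derivative M) - derivative M ^ 2).coeff (2 * M.natDegree) =
      M.leadingCoeff ^ 2 := by
    rw [coeff_sub, coeff_add]
    have h1 : (M ^ 2).coeff (2 * M.natDegree) = M.leadingCoeff ^ 2 := coeff_pow_mul_natDegree M 2
    have hd1 : (derivative M).natDegree ≤ M.natDegree - 1 := natDegree_derivative_le M
    have hd2 : (derivative (derivative M)).natDegree ≤ M.natDegree - 1 :=
      (natDegree_derivative_le _).trans (by omega)
    have h2 : (M * derivative (derivative M)).coeff (2 * M.natDegree) = 0 := by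
      apply coeff_eq_zero_of_natDegree_lt
      calc (M * derivative (derivative M)).natDegree ≤ M.natDegree + (M.natDegree - 1) :=
            natDegree_mul_le.trans (by gcongr)
        _ < 2 * M.natDegree := by omega
    have h3 : (derivative M ^ 2).coeff (2 * M.natDegree) = 0 := by
      apply coeff_eq_zero_of_natDegree_lt
      calc (derivative M ^ 2).natDegree ≤ 2 * (M.natDegree - 1) :=
            natDegree_pow_le_of_le 2 hd1
        _ < 2 * M.natDegree := by omega
    rw [h1, h2, h3, add_zero, sub_zero]
  rw [h, coeff_zero] at hc
  exact pow_ne_zero 2 (leadingCoeff_ne_zero.mpr hM0) hc.symm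

/-- **Noncritical Belyi map on `ℙ¹` protecting a finite set** ([NCBelyi] Thm. 2.5 in genus `0`,
Scherr–Zieve Thm. 1 for `ℙ¹`), in the `(p, q)`-format and OVER the one-point theorem: assume that
for every finite set `A'` of algebraic complex numbers there is a Belyi pair noncritical at `∞`
sending `A'` into `{0, 1, ∞}` (hypothesis `hW6` — the statement of
`NoncriticalBelyi.exists_belyi_noncritical_infty`).  Then for every finite set `A` of algebraic
numbers and every separable `M ∈ ℚ[x]` of positive degree with no root in `A` there is a Belyi pair
`(P, Q)` noncritical at `∞`, sending `A` into `{0, 1, ∞}`, whose map `P/Q` takes a value outside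
`{0, 1, ∞}` at every root of `M`.  (Apply `hW6` to `A' = g(A) ∪ g(critical points of g)`,
`g = x + M'/M`, and compose by `polar_main`.) [cite: MochizukiNCBelyi2004, Thm 2.5 (genus 0)] -/
theorem exists_belyi_protecting_roots_of
    (hW6 : ∀ A' : Finset ℂ, (∀ a ∈ A', IsAlgebraic ℚ a) →
      ∃ (p q : ℚ[X]) (n : ℕ), 0 < n ∧ p.natDegree = n ∧ q.natDegree = n ∧ (p - q).natDegree = n ∧
        p.coeff (n - 1) * q.coeff n ≠ p.coeff n * q.coeff (n - 1) ∧ IsCoprime p q ∧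
        (∀ z : ℂ, aeval z q ≠ 0 → aeval z (derivative p * q - p * derivative q) = 0 →
          aeval z p = 0 ∨ aeval z p = aeval z q) ∧
        ∀ a ∈ A', aeval a (p * q * (p - q)) = 0)
    (A : Finset ℂ) (hA : ∀ a ∈ A, IsAlgebraic ℚ a) (M : ℚ[X]) (hM : 0 < M.natDegree)
    (hsep : M.Separable) (hAM : ∀ a ∈ A, aeval a M ≠ 0) :
    ∃ (P Q : ℚ[X]) (N : ℕ), 0 < N ∧ P.natDegree = N ∧ Q.natDegree = N ∧ (P - Q).natDegree = N ∧
      P.coeff (N - 1) * Q.coeff N ≠ P.coeff N * Q.coeff (N - 1) ∧ IsCoprime P Q ∧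
      (∀ z : ℂ, aeval z Q ≠ 0 → aeval z (derivative P * Q - P * derivative Q) = 0 →
        aeval z P = 0 ∨ aeval z P = aeval z Q) ∧
      (∀ a ∈ A, aeval a (P * Q * (P - Q)) = 0) ∧
      (∀ γ : ℂ, aeval γ M = 0 → aeval γ P ≠ 0 ∧ aeval γ Q ≠ 0 ∧ aeval γ P ≠ aeval γ Q) := by
  classical
  set Δ : ℚ[X] := M ^ 2 + M * derivative (derivative M) - derivative M ^ 2 with hΔ
  have hΔ0 : Δ ≠ 0 := crit_poly_ne_zero M hM
  have hΔC : Δ.map (algebraMap ℚ ℂ) ≠ 0 := (Polynomial.map_ne_zero_iff (algebraMap ℚ ℂ).injective).2 hΔ0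
  let g : ℂ → ℂ := fun z => z + aeval z (derivative M) / aeval z M
  set A' : Finset ℂ := A.image g ∪ (Δ.map (algebraMap ℚ ℂ)).roots.toFinset.image g with hA'
  have hA'alg : ∀ a ∈ A', IsAlgebraic ℚ a := by
    intro a ha
    rw [hA', mem_union, mem_image, mem_image] at ha
    rcases ha with ⟨x, hx, rfl⟩ | ⟨x, hx, rfl⟩
    · exact (isIntegral_g M (hA x hx).isIntegral).isAlgebraic
    · have hxroot : aeval x Δ = 0 := by
        rw [Multiset.mem_toFinset, mem_roots hΔC, IsRoot.def, eval_map_algebraMap] at hx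
        exact hx
      have hxalg : IsAlgebraic ℚ x := ⟨Δ, hΔ0, hxroot⟩
      exact (isIntegral_g M hxalg.isIntegral).isAlgebraic
  obtain ⟨p, q, n, hn, hp, hq, hpq, hunr, hcop, hbel, hval⟩ := hW6 A' hA'alg
  refine polar_main p q n hn hp hq hpq hunr hcop hbel M hM hsep (↑A) (fun a ha => hAM a ha)
    (fun a ha => hval _ ?_) (fun z hz hzΔ => hval _ ?_)
  · rw [hA', mem_union, mem_image]
    exact Or.inl ⟨a, ha, rfl⟩
  · rw [hA', mem_union]
    refine Or.inr (mem_image.mpr ⟨z, ?_, rfl⟩)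
    rw [Multiset.mem_toFinset, mem_roots hΔC, IsRoot.def, eval_map_algebraMap]
    exact hzΔ


end NoncriticalBelyi

end Literature.NumberTheory.DiophantineGeometry
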